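import Mathlib
import HarnessLib
import Summits.NavierStokesRegularity.NavierStokesRegularity.Theorems.UnthreadedRigidityDoorUnthreadedRigidityVirialHornDegreeTwo

/-!
# Route `UnthreadedRigidityDoor`, item `UnthreadedRigidity` (W2, stmt-NavierStokesRegularity-27585) — LINE g11-1 «VIRIAL HORN»:
# the angular form of a quadratic harmonic, `𝒜(Y_Q) = 16 det[y, Qy, Q²y]`, and the ANGULAR LEMMA S-C in degree two

Prover file (W2 Lean hand ns-crc-p1 g7, KEY-NS #188 (1); `--supports stmt-NavierStokesRegularity-27585 --as helper`).  The VIRIAL HORN sketch states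
(docstring of `angForm`): «for `l = 2`, `𝒜(Y_Q) = 16 det[y,Qy,Q²y]` (g10's discriminant cubic)», and its S-C `AngularLemma` docstring: «`l = 2`:
`det[y,Qy,Q²y] ≡ 0 ⟺ Q` has a repeated eigenvalue».  This file proves the identity in the kernel for every symmetric `Q`
(`angForm_quadY : angForm (quadY Q) y = 16 * discrCubic Q y`; ingredients `gradient (quadY Q) y = 2 Q y`, `gradient ‖∇Y_Q‖² = 8 Q² y`) and
deduces the ANGULAR LEMMA ON QUADRATIC FORMS, `angularLemma_quadY : IsQuadForm Q → (∀ y, angForm (quadY Q) y = 0) → IsZonal (quadY Q)`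
(through g10-2's `zonal_structure` via `isZonal_quadY`).  Then every degree-two solid harmonic is presented as some `Y_Q` (`exists_quadY_of_isHomogeneous_two`, a case analysis on the six
degree-two exponents), giving **the ANGULAR LEMMA IN DEGREE TWO** `angularLemma_two : IsSolidHarmonic 2 Y → (∀ y, angForm Y y = 0) → IsZonal Y`
— the `l = 2` instance of S-C exactly as the sketch types it; and `angularLemma_one` (degree one: `Y = ⟪c,·⟫` is zonal about `c`, no
hypothesis on the angular form needed).  The full S-C `AngularLemma` (degrees `l ≥ 3`) is NOT claimed.

HONEST LABEL: algebra/calculus about SPECIAL separable data; `UnthreadedRigidity` (27585), W2 and NS regularity remain OPEN.  0 kit.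
-/

-- the summit and its single sub-problem share the name (CONVENTIONS §1), as in every Theorems file
set_option linter.dupNamespace false

namespace Summit.NavierStokesRegularity.NavierStokesRegularity.Theorems.UnthreadedRigidity.VirialHorn

open scoped Topology InnerProductSpace
open Filter Set
open Summit.NavierStokesRegularity.NavierStokesRegularity.Theorems.UnthreadedRigidity.ProfileHorn (E3 IsQuadForm quadY discrCubic IsZonalForm det_rows_three)

/-- the gradient of `Y_Q` for a symmetric `Q`: `∇Y_Q(y) = 2 Q y`, in coordinates. -/
theorem hasGradientAt_quadY {Q : Matrix (Fin 3) (Fin 3) ℝ} (hQ : Q.IsSymm) (y : E3) :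
    HasGradientAt (quadY Q) (WithLp.toLp 2 fun i => 2 * ∑ j : Fin 3, Q i j * y j) y := by
  rw [hasGradientAt_iff_hasFDerivAt]
  refine (hasFDerivAt_quadY Q y).congr_fderiv ?_
  ext v
  have hs : ∀ i j : Fin 3, Q j i = Q i j := fun i j => by
    have := congrFun (congrFun hQ i) j
    simpa [Matrix.transpose_apply] using this
  simp [InnerProductSpace.toDual_apply_apply, Literature.Geometry.Lorentzian.Kerr.Ingoing.inner_e3, Fin.sum_univ_three, hs]
  ring

/-- `∇Y_Q` as a function, for symmetric `Q`. -/
theorem gradient_quadY {Q : Matrix (Fin 3) (Fin 3) ℝ} (hQ : Q.IsSymm) :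
    gradient (quadY Q) = fun y : E3 => WithLp.toLp 2 fun i => 2 * ∑ j : Fin 3, Q i j * y j :=
  funext fun y => (hasGradientAt_quadY hQ y).gradient

/-- the gradient of `‖∇Y_Q‖²`: `8 Q² y`, in coordinates. -/
theorem hasGradientAt_norm_gradient_quadY_sq {Q : Matrix (Fin 3) (Fin 3) ℝ} (hQ : Q.IsSymm) (y : E3) :
    HasGradientAt (fun z : E3 => ‖gradient (quadY Q) z‖ ^ 2)
      (WithLp.toLp 2 fun i => 8 * ∑ k : Fin 3, ∑ j : Fin 3, Q k i * Q k j * y j) y := by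
  have hs : ∀ i j : Fin 3, Q j i = Q i j := fun i j => by
    have := congrFun (congrFun hQ i) j
    simpa [Matrix.transpose_apply] using this
  -- rewrite the function as an explicit polynomial in the coordinates
  have hfun : (fun z : E3 => ‖gradient (quadY Q) z‖ ^ 2) = fun z : E3 => ∑ i : Fin 3, (2 * ∑ j : Fin 3, Q i j * z j) ^ 2 := by
    funext z
    rw [gradient_quadY hQ, EuclideanSpace.norm_eq, Real.sq_sqrt (Finset.sum_nonneg fun i _ => by positivity)]
    simp [Real.norm_eq_abs, mul_pow, sq_abs]
  rw [hfun, hasGradientAt_iff_hasFDerivAt]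
  have hterm : ∀ i j : Fin 3, HasFDerivAt (fun z : E3 => Q i j * z j) ((Q i j) • (EuclideanSpace.proj j : E3 →L[ℝ] ℝ)) y :=
    fun i j => by simpa using ((EuclideanSpace.proj j : E3 →L[ℝ] ℝ).hasFDerivAt.const_mul (Q i j))
  have hsum : ∀ i : Fin 3, HasFDerivAt (fun z : E3 => ∑ j : Fin 3, Q i j * z j)
      (∑ j : Fin 3, (Q i j) • (EuclideanSpace.proj j : E3 →L[ℝ] ℝ)) y :=
    fun i => HasFDerivAt.fun_sum fun j _ => hterm i j
  have hlin : ∀ i : Fin 3, HasFDerivAt (fun z : E3 => 2 * ∑ j : Fin 3, Q i j * z j)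
      ((2 : ℝ) • ∑ j : Fin 3, (Q i j) • (EuclideanSpace.proj j : E3 →L[ℝ] ℝ)) y :=
    fun i => (hsum i).const_mul 2
  have hsq := HasFDerivAt.fun_sum fun i (_ : i ∈ (Finset.univ : Finset (Fin 3))) => (hlin i).pow 2
  refine (hsq.congr_of_eventuallyEq (Eventually.of_forall fun z => rfl)).congr_fderiv ?_
  ext v
  simp [InnerProductSpace.toDual_apply_apply, Literature.Geometry.Lorentzian.Kerr.Ingoing.inner_e3, Fin.sum_univ_three, hs]
  ring

/-- **THE ANGULAR FORM OF A QUADRATIC HARMONIC**: `𝒜(Y_Q)(y) = 16 det[y, Qy, Q²y]` for symmetric `Q` (the VIRIAL HORN sketch's docstring claim,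
now a kernel identity). -/
theorem angForm_quadY {Q : Matrix (Fin 3) (Fin 3) ℝ} (hQ : Q.IsSymm) (y : E3) : angForm (quadY Q) y = 16 * discrCubic Q y := by
  have hs : ∀ i j : Fin 3, Q j i = Q i j := fun i j => by
    have := congrFun (congrFun hQ i) j
    simpa [Matrix.transpose_apply] using this
  unfold angForm pbr
  rw [(hasGradientAt_quadY hQ y).gradient, (hasGradientAt_norm_gradient_quadY_sq hQ y).gradient]
  unfold discrCubic
  rw [det_rows_three]
  simp only [det3, Matrix.mulVec, dotProduct, Matrix.mul_apply, Fin.sum_univ_three, hs]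
  ring

/-- **ANGULAR LEMMA FOR QUADRATIC FORMS** (S-C of LINE g11-1 on the image of `quadY`): a traceless symmetric form whose angular form vanishes
identically is zonal, hence `Y_Q` is a zonal harmonic (`𝒜(Y_Q) = 16 D_Q`, so `D_Q ≡ 0`, and g10-2's `zonal_structure` via `isZonal_quadY`). -/
theorem angularLemma_quadY {Q : Matrix (Fin 3) (Fin 3) ℝ} (hQ : IsQuadForm Q) (hA : ∀ y : E3, angForm (quadY Q) y = 0) :
    IsZonal (quadY Q) := by
  have hz : IsZonalForm Q := fun y _ => by
    have := hA y
    rw [angForm_quadY hQ.1 y] at this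
    linarith
  exact isZonal_quadY hQ hz

/-! ## Every degree-two solid harmonic is a `Y_Q`; the ANGULAR LEMMA in degree two -/

/-- the matrix of a degree-two exponent `d` (`Σ dᵢ = 2`): `y^d = Σᵢⱼ yᵢ M(d)ᵢⱼ yⱼ` with `M(d) = ½ (d dᵀ − diag d)`. -/
theorem monomial_two_eq_quadY (d : Fin 3 →₀ ℕ) (hd : d 0 + d 1 + d 2 = 2) (y : E3) :
    (∏ i : Fin 3, y i ^ d i) = quadY (Matrix.of fun i j : Fin 3 =>
      ((d i : ℝ) * (d j : ℝ) - if i = j then (d i : ℝ) else 0) / 2) y := by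
  have h0 : d 0 ≤ 2 := by omega
  have h1 : d 1 ≤ 2 := by omega
  have h2 : d 2 ≤ 2 := by omega
  simp only [quadY, Fin.sum_univ_three, Fin.prod_univ_three, Matrix.of_apply]
  interval_cases h0' : d 0 <;> interval_cases h1' : d 1 <;> interval_cases h2' : d 2 <;> simp_all <;> ring

/-- `quadY` is linear in the matrix. -/
theorem quadY_sum_smul {ι : Type*} (s : Finset ι) (c : ι → ℝ) (M : ι → Matrix (Fin 3) (Fin 3) ℝ) (y : E3) :
    quadY (∑ k ∈ s, c k • M k) y = ∑ k ∈ s, c k * quadY (M k) y := by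
  classical
  induction s using Finset.induction_on with
  | empty => simp [quadY]
  | insert a s ha ih =>
    rw [Finset.sum_insert ha, Finset.sum_insert ha, ← ih]
    simp only [quadY, Matrix.add_apply, Matrix.smul_apply, smul_eq_mul, Finset.mul_sum]
    rw [← Finset.sum_add_distrib]
    refine Finset.sum_congr rfl fun i _ => ?_
    rw [← Finset.sum_add_distrib]
    refine Finset.sum_congr rfl fun j _ => ?_
    ring

/-- a homogeneous polynomial of degree two in three variables is a quadratic form `Y_Q` with `Q` symmetric. -/
theorem exists_quadY_of_isHomogeneous_two (P : MvPolynomial (Fin 3) ℝ) (hP : P.IsHomogeneous 2) :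
    ∃ Q : Matrix (Fin 3) (Fin 3) ℝ, Q.IsSymm ∧ ∀ y : E3, MvPolynomial.eval (fun i => y i) P = quadY Q y := by
  classical
  set M : (Fin 3 →₀ ℕ) → Matrix (Fin 3) (Fin 3) ℝ := fun d => Matrix.of fun i j : Fin 3 =>
    ((d i : ℝ) * (d j : ℝ) - if i = j then (d i : ℝ) else 0) / 2 with hM
  refine ⟨∑ d ∈ P.support, P.coeff d • M d, ?_, fun y => ?_⟩
  · -- symmetric
    unfold Matrix.IsSymm
    ext i j
    simp only [Matrix.transpose_apply, Matrix.sum_apply, Matrix.smul_apply, smul_eq_mul, hM, Matrix.of_apply]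
    refine Finset.sum_congr rfl fun d _ => ?_
    by_cases hij : i = j
    · subst hij; rfl
    · rw [if_neg hij, if_neg (Ne.symm hij)]; ring
  · rw [quadY_sum_smul, MvPolynomial.eval_eq']
    refine Finset.sum_congr rfl fun d hd => ?_
    have hdeg : d 0 + d 1 + d 2 = 2 := by
      have h1 := hP (MvPolynomial.mem_support_iff.mp hd)
      have h2 : Finsupp.degree d = 2 := by rw [Finsupp.degree_eq_weight_one]; exact h1
      rw [Finsupp.degree_eq_sum, Fin.sum_univ_three] at h2
      exact h2
    rw [monomial_two_eq_quadY d hdeg y]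

/-- the flat Laplacian of `Y_Q` is `2 tr Q` (any `Q`). -/
theorem lap3_quadY (Q : Matrix (Fin 3) (Fin 3) ℝ) (y : E3) : lap3 (quadY Q) y = 2 * (Q 0 0 + Q 1 1 + Q 2 2) := by
  unfold lap3 dir2
  have hder : ∀ k : Fin 3, (fun z : E3 => fderiv ℝ (quadY Q) z (e k)) = fun z => ∑ j : Fin 3, Q k j * z j + ∑ i : Fin 3, z i * Q i k := by
    intro k; funext z; exact fderiv_quadY_single Q z k
  simp only [hder]
  have hlin : ∀ k : Fin 3, fderiv ℝ (fun z : E3 => ∑ j : Fin 3, Q k j * z j + ∑ i : Fin 3, z i * Q i k) y (e k) = Q k k + Q k k := by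
    intro k
    have hf : HasFDerivAt (fun z : E3 => ∑ j : Fin 3, Q k j * z j + ∑ i : Fin 3, z i * Q i k)
        (∑ j : Fin 3, (Q k j) • (EuclideanSpace.proj j : E3 →L[ℝ] ℝ) + ∑ i : Fin 3, (Q i k) • (EuclideanSpace.proj i : E3 →L[ℝ] ℝ)) y := by
      refine HasFDerivAt.add ?_ ?_
      · exact HasFDerivAt.fun_sum fun j _ => by
          simpa using ((EuclideanSpace.proj j : E3 →L[ℝ] ℝ).hasFDerivAt.const_mul (Q k j))
      · exact HasFDerivAt.fun_sum fun i _ => by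
          simpa [mul_comm] using ((EuclideanSpace.proj i : E3 →L[ℝ] ℝ).hasFDerivAt.mul_const (Q i k))
    rw [hf.fderiv]
    simp only [FunLike.coe_sum, Finset.sum_apply, FunLike.coe_add, FunLike.coe_smul,
      Pi.add_apply, Pi.smul_apply, smul_eq_mul, e]
    fin_cases k <;> simp
  rw [Fin.sum_univ_three, hlin 0, hlin 1, hlin 2]
  ring

/-- **THE ANGULAR LEMMA IN DEGREE TWO** (S-C of LINE g11-1 at `l = 2`, complete): a degree-two solid harmonic whose angular form `{Y, |∇Y|²}`
vanishes identically is zonal.  (Write `Y = Y_Q` with `Q` symmetric, traceless by harmonicity; `𝒜(Y_Q) = 16 D_Q`; `D_Q ≡ 0` ⇒ repeated eigenvalue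
⇒ axis.) -/
theorem angularLemma_two (Y : E3 → ℝ) (hY : IsSolidHarmonic 2 Y) (hA : ∀ y : E3, angForm Y y = 0) : IsZonal Y := by
  obtain ⟨⟨P, hPh, hPe⟩, hlap⟩ := hY
  obtain ⟨Q, hQs, hQe⟩ := exists_quadY_of_isHomogeneous_two P hPh
  have hYQ : Y = quadY Q := funext fun y => (hPe y).trans (hQe y)
  have htr : Q.trace = 0 := by
    have h0 := hlap 0
    rw [hYQ, lap3_quadY] at h0
    rw [Matrix.trace_fin_three]
    linarith
  rw [hYQ] at hA ⊢
  exact angularLemma_quadY ⟨hQs, htr⟩ hA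

/-! ## Degree one: every solid harmonic of degree one is zonal -/

/-- a homogeneous polynomial of degree one in three variables is a linear form. -/
theorem exists_linear_of_isHomogeneous_one (P : MvPolynomial (Fin 3) ℝ) (hP : P.IsHomogeneous 1) :
    ∃ c : Fin 3 → ℝ, ∀ y : E3, MvPolynomial.eval (fun i => y i) P = c 0 * y 0 + c 1 * y 1 + c 2 * y 2 := by
  classical
  refine ⟨fun k => ∑ d ∈ P.support, if d k = 1 then P.coeff d else 0, fun y => ?_⟩
  rw [MvPolynomial.eval_eq']
  simp only [Finset.sum_ite, Finset.sum_const_zero, add_zero]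
  rw [Finset.sum_mul, Finset.sum_mul, Finset.sum_mul]
  -- each monomial is one coordinate
  have key : ∀ d ∈ P.support, P.coeff d * ∏ i : Fin 3, y i ^ d i
      = (if d 0 = 1 then P.coeff d * y 0 else 0) + (if d 1 = 1 then P.coeff d * y 1 else 0)
        + (if d 2 = 1 then P.coeff d * y 2 else 0) := by
    intro d hd
    have h1 := hP (MvPolynomial.mem_support_iff.mp hd)
    have h2 : Finsupp.degree d = 1 := by rw [Finsupp.degree_eq_weight_one]; exact h1
    rw [Finsupp.degree_eq_sum, Fin.sum_univ_three] at h2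
    have h0 : d 0 ≤ 1 := by omega
    have h1' : d 1 ≤ 1 := by omega
    have h2' : d 2 ≤ 1 := by omega
    simp only [Fin.prod_univ_three]
    interval_cases e0 : d 0 <;> interval_cases e1 : d 1 <;> interval_cases e2 : d 2 <;> simp_all
  rw [Finset.sum_congr rfl key, Finset.sum_add_distrib, Finset.sum_add_distrib]
  simp only [Finset.sum_filter]

/-- **THE ANGULAR LEMMA IN DEGREE ONE** (S-C of LINE g11-1 at `l = 1`; the sketch: «`l = 1`: every `Y` is zonal»): a degree-one solid harmonic
`Y = ⟪c, ·⟫` is zonal about `c` (about any axis if `c = 0`); the angular-form hypothesis is not even needed. -/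
theorem angularLemma_one (Y : E3 → ℝ) (hY : IsSolidHarmonic 1 Y) : IsZonal Y := by
  obtain ⟨⟨P, hPh, hPe⟩, -⟩ := hY
  obtain ⟨c, hc⟩ := exists_linear_of_isHomogeneous_one P hPh
  have hYc : Y = fun y : E3 => c 0 * y 0 + c 1 * y 1 + c 2 * y 2 := funext fun y => (hPe y).trans (hc y)
  set cv : E3 := WithLp.toLp 2 ![c 0, c 1, c 2] with hcv
  have hgrad : ∀ y : E3, gradient Y y = cv := by
    intro y
    have hlin : HasFDerivAt Y (c 0 • (EuclideanSpace.proj 0 : E3 →L[ℝ] ℝ) + c 1 • (EuclideanSpace.proj 1 : E3 →L[ℝ] ℝ)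
        + c 2 • (EuclideanSpace.proj 2 : E3 →L[ℝ] ℝ)) y := by
      rw [hYc]
      exact ((((EuclideanSpace.proj 0 : E3 →L[ℝ] ℝ).hasFDerivAt.const_mul (c 0)).add
        (((EuclideanSpace.proj 1 : E3 →L[ℝ] ℝ).hasFDerivAt.const_mul (c 1)))).add
        (((EuclideanSpace.proj 2 : E3 →L[ℝ] ℝ).hasFDerivAt.const_mul (c 2))))
    have hg : HasGradientAt Y cv y := by
      rw [hasGradientAt_iff_hasFDerivAt]
      refine hlin.congr_fderiv ?_
      ext v
      simp [InnerProductSpace.toDual_apply_apply, Literature.Geometry.Lorentzian.Kerr.Ingoing.inner_e3, hcv]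
    exact hg.gradient
  by_cases h0 : cv = 0
  · refine ⟨e 0, by simp [e], fun y => ?_⟩
    rw [hgrad y, h0]
    simp [det3]
  · refine ⟨cv, h0, fun y => ?_⟩
    rw [hgrad y]
    simp only [det3]
    ring

end Summit.NavierStokesRegularity.NavierStokesRegularity.Theorems.UnthreadedRigidity.VirialHorn
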